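import Literature.MathematicalPhysics.QuantumLattice.FermionicTreeExpansionFieldLines
import Literature.MathematicalPhysics.QuantumLattice.FermionicTreeExpansionDetBoundDecay
import Literature.Probability.LatticeModels.KernelTreeDecay
import HarnessLib

/-!
# The single-scale tree estimate for EXTENDED (kernel-weighted) vertices

Topic `Literature/MathematicalPhysics/QuantumLattice`; the companion of
`FermionicTreeExpansionDetBoundDecay.lean` needed below the first scale of a multiscale expansion.
There the `n!`-free estimate `Σ_{p : p v = a} ‖𝓔ᵀ_p(ι)‖ ≤ |ι|^{|ι|-2} δ^{|F|} (2n² ‖γ‖₁)^{|ι|-1}` was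
proved for LOCAL clusters: all the fields of the cluster `x` sit at one point `p x` of the torus `Λ`.
The effective potentials produced by the integration of the higher scales are not local: a vertex of
the scale-`h` tree expansion is a monomial `∫ dx₁⋯dx_{2m} W(x₁,…,x_{2m}) ψ(x₁)⋯ψ(x_{2m})` whose fields
sit at independent points weighted by a kernel `W` controlled in the `L¹–L^∞` norm
`‖W‖_{1,∞} = max_i sup_{x_i} ∫ ∏_{j≠i} dx_j |W|` (Benfatto–Giuliani–Mastropietro 2006, (2.67)–(2.70)
and the bound (2.77); Gawȩdzki–Kupiainen 1985; Gentile–Mastropietro 2001, §4; Salmhofer 1998, §4.1).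
This file assembles the corresponding estimate from the field-line form of the determinant-bound tree
estimate (`FermionicTreeExpansionFieldLines.lean`), the tree-decay lemma for extended vertices
(`KernelTreeDecay.lean`: peeling the leaves) and Cayley's count of the anchored cluster trees:

* `card_filter_pairType_univ_le` — at most `2n²` field lines of a cluster type;
* **`sum_kernel_norm_ursellOf_moment_le_of_twoPointBound`** — the fields occupy slots `τ : S` of the
  clusters (`cS τ : ι`) at positions `x τ ∈ Λ`; for a family of propagator matrices `G_x` with a
  position-uniform determinant bound `δ` and a two-point line bound `‖G_x f f'‖ ≤ h(x(sb f), x(su f'))`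
  (`sb f`, `su f` the slots of the two fields of the pair `f`; `h ≥ 0` with row and column sums `≤ Γ`),
  kernels `K u ≥ 0` depending on the slots of `u` only with `Σ_{slots of u, any one pinned} K u ≤ N u`, and
  at most `n` field pairs per cluster,
  `Σ_{x : x τ₀ = a} (∏_u K u x) ‖𝓔ᵀ_x(ι)‖ ≤ |ι|^{|ι|-2} δ^{|F|} (2 n² Γ)^{|ι|-1} ∏_u N u`;
  `sum_kernel_norm_ursellOf_moment_le_of_detBound` — the translation invariant form
  `h(b, b') = γ(b - b')`, `Γ = Σ_z γ z`
  — Benfatto–Giuliani–Mastropietro 2006, the bound (2.77) for general effective vertices: Cayley's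
  `|ι|^{|ι|-2}` anchored trees, `2n²` field-line choices and one `‖γ‖₁` per tree line, one kernel norm per
  vertex, `δ^{|F|}` for the last determinant, no factorial in the number of fields.

Everything is PROVED; no definition of physical content and no named fact.

## References
* G. Benfatto, A. Giuliani, V. Mastropietro, Ann. Henri Poincaré 7 (2006) 809–898, (2.66)–(2.77).
  [cite: BenfattoGiulianiMastropietro2006, (2.66)-(2.77)]
* K. Gawȩdzki, A. Kupiainen, Comm. Math. Phys. 102 (1985) 1–30, §3 (the tree bound with `L¹–L^∞`
  kernel norms). [cite: GawedzkiKupiainen1985GrossNeveu, §3]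
* M. Salmhofer, Comm. Math. Phys. 194 (1998) 249–295, §4.1 (the norm). [cite: Salmhofer1998, §4.1]
* V. Mastropietro, *Non-Perturbative Renormalization* (2008), §2.9–2.10, §3.1. [cite: Mastropietro2008, §3.1]
-/

noncomputable section

open MvPolynomial Finsupp Matrix Finset Literature.RingTheory.MvPolynomial
open Literature.Probability.LatticeModels Literature.Probability.LatticeModels.BattleFederbush
open Literature.MeasureTheory.Integral Literature.Analysis.InnerProduct
open scoped InnerProductSpace

namespace Literature.MathematicalPhysics.QuantumLattice

namespace FermionicTree

variable {𝕜 : Type*} [RCLike 𝕜]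
variable {ι : Type*} [DecidableEq ι] [Fintype ι] {F : Type*} [Fintype F] [LinearOrder F]
variable (c : F → ι)

section Main

variable {S : Type*} [Fintype S] [DecidableEq S] {Λ : Type*} [AddCommGroup Λ] [Fintype Λ] [DecidableEq Λ]

omit [Fintype ι] [LinearOrder F] in
/-- There are at most `2 n²` field lines `(f, f') : F × F` of a given cluster type when every cluster has at
most `n` field pairs. [folklore] -/
theorem card_filter_pairType_univ_le (n : ℕ) (hn : ∀ u : ι, (univ.filter fun f : F => c f = u).card ≤ n)
    (ℓ : Sym2 ι) : (univ.filter fun q : F × F => s(c q.1, c q.2) = ℓ).card ≤ 2 * n ^ 2 := by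
  classical
  refine Sym2.inductionOn ℓ fun u u' => ?_
  set T : ι → Finset F := fun z => univ.filter fun f : F => c f = z with hT
  calc (univ.filter fun q : F × F => s(c q.1, c q.2) = s(u, u')).card
      ≤ ((T u ×ˢ T u') ∪ (T u' ×ˢ T u)).card := by
        refine card_le_card fun q hq => ?_
        rw [mem_filter] at hq
        rcases Sym2.eq_iff.1 hq.2 with ⟨h1, h2⟩ | ⟨h1, h2⟩
        · exact mem_union_left _ (mem_product.2 ⟨by simp [hT, h1], by simp [hT, h2]⟩)
        · exact mem_union_right _ (mem_product.2 ⟨by simp [hT, h1], by simp [hT, h2]⟩)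
    _ ≤ (T u ×ˢ T u').card + (T u' ×ˢ T u).card := card_union_le _ _
    _ ≤ n * n + n * n := by
        rw [card_product, card_product]
        exact add_le_add (Nat.mul_le_mul (hn u) (hn u')) (Nat.mul_le_mul (hn u') (hn u))
    _ = 2 * n ^ 2 := by ring

/-- **The single-scale `n!`-free estimate for extended (kernel-weighted) vertices, two-point form**
(Benfatto–Giuliani–Mastropietro 2006, the bound (2.77) for general effective vertices; Gawȩdzki–Kupiainen
1985; Gentile–Mastropietro 2001, §4): the fields occupy slots `τ : S` of the clusters (`cS τ : ι`), at
positions `x τ ∈ Λ`; the field pair `f` has its `ψ̄`-field in the slot `sb f` and its `ψ`-field in the slot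
`su f` (both slots of the cluster `c f`); the propagator matrices `G_x` have a position-uniform determinant
bound `δ ≥ 1` and a two-point line bound `‖G_x f f'‖ ≤ h(x(sb f), x(su f'))` with `h ≥ 0` of row and column
sums `≤ Γ`; the cluster `u` carries a kernel `K u x ≥ 0` depending only on the positions of its own slots,
with `Σ_{positions of the slots of u, any one slot pinned} K u ≤ N u` (the `L¹–L^∞` norm); at most `n` field
pairs per cluster.  Then, one slot `τ₀` of the root cluster `v` being pinned,
`Σ_{x : x τ₀ = a} (∏_u K u x) ‖𝓔ᵀ_x(ι)‖ ≤ |ι|^{|ι|-2} · δ^{|F|} (2 n² Γ)^{|ι|-1} · ∏_u N u`: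
Cayley's count of the anchored cluster trees, `2n²` field-line choices and one `Γ` per tree line (peeling
the leaves, `BattleFederbush.sum_kernelProd_lineProd_le`), one kernel norm per vertex and `δ^{|F|}` for the
last interpolated determinant. [cite: BenfattoGiulianiMastropietro2006, (2.66)-(2.77)] -/
theorem sum_kernel_norm_ursellOf_moment_le_of_twoPointBound (cS : S → ι) (Gx : (S → Λ) → Matrix F F 𝕜)
    {δ : ℝ} (hδ : 1 ≤ δ)
    (hDB : ∀ (x : S → Λ) (m r : ℕ) (w : Fin r → EuclideanSpace ℝ (Fin m)), (∀ a, ‖w a‖ = 1) →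
      ∀ (e : Fin r ↪o F) (c' : ℕ) (ρ γ : Fin c' → Fin r), StrictMono ρ → StrictMono γ →
        ‖(Matrix.of fun a b : Fin c' =>
            ((⟪w (ρ a), w (γ b)⟫_ℝ : ℝ) : 𝕜) * Gx x (e (ρ a)) (e (γ b))).det‖ ≤ δ ^ c')
    (h2 : Λ → Λ → ℝ) (hh0 : ∀ b b', 0 ≤ h2 b b') {Γ : ℝ} (hrow : ∀ b, ∑ b', h2 b b' ≤ Γ)
    (hcol : ∀ b', ∑ b, h2 b b' ≤ Γ) (sb su : F → S) (hsb : ∀ f, cS (sb f) = c f)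
    (hsu : ∀ f, cS (su f) = c f) (hG : ∀ x f f', ‖Gx x f f'‖ ≤ h2 (x (sb f)) (x (su f')))
    (n : ℕ) (hn : ∀ u : ι, (fieldsOf c {u}).card ≤ n)
    (K : ι → (S → Λ) → ℝ) (hK0 : ∀ u x, 0 ≤ K u x)
    (hKloc : ∀ u x x', (∀ τ, cS τ = u → x τ = x' τ) → K u x = K u x')
    (N : ι → ℝ) (hN0 : ∀ u, 0 ≤ N u)
    (hKN : ∀ u τ, cS τ = u → ∀ a : Λ,
      ∑ x ∈ univ.filter (fun x : S → Λ => x τ = a ∧ ∀ τ', cS τ' ≠ u → x τ' = 0), K u x ≤ N u)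
    {v : ι} (τ₀ : S) (hτ₀ : cS τ₀ = v) (a : Λ) :
    ∑ x ∈ univ.filter (fun x : S → Λ => x τ₀ = a), (∏ u, K u x) * ‖ursellOf (moment c (Gx x)) univ‖ ≤
      (Fintype.card ι : ℝ) ^ (Fintype.card ι - 2) *
        (δ ^ Fintype.card F * (2 * (n : ℝ) ^ 2 * Γ) ^ (Fintype.card ι - 1)) * ∏ u, N u := by
  classical
  have hv : v ∈ (univ : Finset ι) := mem_univ v
  have hΓ : 0 ≤ Γ := le_trans (sum_nonneg fun b' _ => hh0 a b') (hrow a)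
  have hδ0 : 0 ≤ δ := zero_le_one.trans hδ
  have hNprod : 0 ≤ ∏ u, N u := prod_nonneg fun u _ => hN0 u
  have hKprod : ∀ x : S → Λ, 0 ≤ ∏ u, K u x := fun x => prod_nonneg fun u _ => hK0 u x
  have hnF : ∀ u : ι, (univ.filter fun f : F => c f = u).card ≤ n := fun u => by
    refine le_trans (le_of_eq ?_) (hn u)
    congr 1; ext f; simp [mem_fieldsOf]
  -- the field lines of a type and their two-point weights
  set LT : Sym2 ι → Finset (F × F) := fun ℓ => univ.filter fun q : F × F => s(c q.1, c q.2) = ℓ with hLT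
  set g : F × F → (S → Λ) → ℝ := fun q x => h2 (x (sb q.1)) (x (su q.2)) with hg
  -- Step 1: the field-line tree bound at every position, with `‖G_x f f'‖ ≤ h` on every field line
  have step1 : ∀ x : S → Λ, ‖ursellOf (moment c (Gx x)) univ‖ ≤
      ∑ T ∈ lineSets v (univ : Finset ι), δ ^ Fintype.card F * ∏ ℓ ∈ T, ∑ q ∈ LT ℓ, g q x := by
    intro x
    have h := norm_ursellOf_moment_le_sum_lineSets_fieldLineSum_of_detBound c (Gx x) hδ (hDB x) univ hv
    rw [fieldsOf_univ, card_univ] at h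
    refine h.trans (sum_le_sum fun T _ => mul_le_mul_of_nonneg_left ?_ (by positivity))
    refine prod_le_prod (fun ℓ _ => sum_nonneg fun q _ => norm_nonneg _) fun ℓ _ => ?_
    exact sum_le_sum fun q _ => hG x q.1 q.2
  -- Step 2: each anchored cluster tree contributes at most `(2n²Γ)^{|ι|-1} ∏ N`
  have step2 : ∀ T ∈ lineSets v (univ : Finset ι),
      ∑ x ∈ univ.filter (fun x : S → Λ => x τ₀ = a), (∏ u, K u x) * ∏ ℓ ∈ T, ∑ q ∈ LT ℓ, g q x ≤
        (2 * (n : ℝ) ^ 2 * Γ) ^ (Fintype.card ι - 1) * ∏ u, N u := by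
    intro T hT
    obtain ⟨k, -, s, hs, huniv, rfl⟩ := mem_lineSets.1 hT
    have hk : k + 1 = Fintype.card ι := by
      rw [← Script.card_image_y s hs, huniv, card_univ]
    have hTcard : s.lines.toFinset.card = k := by
      rw [List.toFinset_card_of_nodup (Script.nodup_lines s hs), Script.length_lines]
    -- the kernel bound in script order
    have hNscript : N v * (Γ ^ k * ∏ m : Fin k, N (s.y m.succ)) = Γ ^ k * ∏ u, N u := by
      have hbij : Function.Bijective s.y :=
        ⟨Script.y_injective s hs, fun u => by
          obtain ⟨m, -, hm⟩ := mem_image.1 (huniv.symm ▸ mem_univ u); exact ⟨m, hm⟩⟩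
      rw [← hbij.prod_comp N, Fin.prod_univ_succ, Script.y_zero]
      ring
    -- expand the product of the field-line sums into a sum over the choices
    have hexp : ∀ x : S → Λ, ∏ ℓ ∈ s.lines.toFinset, ∑ q ∈ LT ℓ, g q x =
        ∑ φ ∈ Fintype.piFinset (fun ℓ : s.lines.toFinset => LT ℓ), ∏ ℓ : s.lines.toFinset, g (φ ℓ) x := by
      intro x
      rw [← prod_coe_sort, Finset.prod_univ_sum]
    -- the contribution of one choice
    have hchoice : ∀ φ ∈ Fintype.piFinset (fun ℓ : s.lines.toFinset => LT ℓ),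
        ∑ x ∈ univ.filter (fun x : S → Λ => x τ₀ = a), (∏ u, K u x) * ∏ ℓ : s.lines.toFinset, g (φ ℓ) x ≤
          Γ ^ k * ∏ u, N u := by
      intro φ hφ
      -- the line weights of this choice
      set w : Sym2 ι → (S → Λ) → ℝ := fun ℓ x =>
        if h : ℓ ∈ s.lines.toFinset then g (φ ⟨ℓ, h⟩) x else 1 with hw
      have hwprod : ∀ x : S → Λ, ∏ ℓ : s.lines.toFinset, g (φ ℓ) x = (s.lines.map fun ℓ => w ℓ x).prod := by
        intro x
        rw [← List.prod_toFinset _ (Script.nodup_lines s hs),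
          ← prod_coe_sort s.lines.toFinset fun ℓ => w ℓ x]
        refine prod_congr rfl fun ℓ _ => ?_
        have hℓ : (ℓ : Sym2 ι) ∈ s.lines := List.mem_toFinset.1 ℓ.2
        simp [hw, hℓ]
      have hwlines : ∀ ℓ ∈ s.lines, ∃ (τ₁ τ₂ : S) (h : Λ → Λ → ℝ), s(cS τ₁, cS τ₂) = ℓ ∧
          (∀ x, w ℓ x = h (x τ₁) (x τ₂)) ∧ (∀ b b', 0 ≤ h b b') ∧
          (∀ b, ∑ b', h b b' ≤ Γ) ∧ (∀ b', ∑ b, h b b' ≤ Γ) := by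
        intro ℓ hℓ
        have hℓT : ℓ ∈ s.lines.toFinset := List.mem_toFinset.2 hℓ
        have hq : φ ⟨ℓ, hℓT⟩ ∈ LT ℓ := Fintype.mem_piFinset.1 hφ ⟨ℓ, hℓT⟩
        set q := φ ⟨ℓ, hℓT⟩ with hqdef
        have htype : s(c q.1, c q.2) = ℓ := (mem_filter.1 hq).2
        refine ⟨sb q.1, su q.2, h2, ?_, fun x => ?_, hh0, hrow, hcol⟩
        · rw [hsb, hsu, htype]
        · rw [hw]
          simp only [hℓT, dif_pos]
          rfl
      have hpeel := sum_kernelProd_lineProd_le cS K hK0 hKloc N hKN hΓ w s hs hwlines τ₀ hτ₀ a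
      rw [huniv, hNscript] at hpeel
      refine le_trans (le_of_eq ?_) hpeel
      refine sum_congr ?_ fun x _ => by rw [hwprod]
      ext x
      simp
    -- sum over the choices and count them
    have hcount : ((Fintype.piFinset fun ℓ : s.lines.toFinset => LT ℓ).card : ℝ) ≤
        (2 * (n : ℝ) ^ 2) ^ k := by
      rw [Fintype.card_piFinset]
      push_cast
      calc ∏ ℓ : s.lines.toFinset, ((LT ℓ).card : ℝ) ≤ ∏ _ℓ : s.lines.toFinset, (2 * (n : ℝ) ^ 2) :=
            prod_le_prod (fun ℓ _ => by positivity) fun ℓ _ => by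
              exact_mod_cast card_filter_pairType_univ_le c n hnF ℓ
        _ = (2 * (n : ℝ) ^ 2) ^ k := by
            rw [prod_const, card_univ, Fintype.card_coe, hTcard]
    calc ∑ x ∈ univ.filter (fun x : S → Λ => x τ₀ = a), (∏ u, K u x) * ∏ ℓ ∈ s.lines.toFinset, ∑ q ∈ LT ℓ, g q x
        = ∑ φ ∈ Fintype.piFinset (fun ℓ : s.lines.toFinset => LT ℓ),
            ∑ x ∈ univ.filter (fun x : S → Λ => x τ₀ = a), (∏ u, K u x) * ∏ ℓ : s.lines.toFinset, g (φ ℓ) x := by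
          rw [Finset.sum_comm]
          refine sum_congr rfl fun x _ => ?_
          rw [hexp, Finset.mul_sum]
      _ ≤ ∑ _φ ∈ Fintype.piFinset (fun ℓ : s.lines.toFinset => LT ℓ), Γ ^ k * ∏ u, N u :=
          sum_le_sum hchoice
      _ = (Fintype.piFinset fun ℓ : s.lines.toFinset => LT ℓ).card * (Γ ^ k * ∏ u, N u) := by
          rw [sum_const, nsmul_eq_mul]
      _ ≤ (2 * (n : ℝ) ^ 2) ^ k * (Γ ^ k * ∏ u, N u) :=
          mul_le_mul_of_nonneg_right hcount (mul_nonneg (pow_nonneg hΓ _) hNprod)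
      _ = (2 * (n : ℝ) ^ 2 * Γ) ^ (Fintype.card ι - 1) * ∏ u, N u := by
          rw [show k = Fintype.card ι - 1 by omega, mul_pow]
          ring
  -- Step 3: exchange the sums and use Cayley's count
  calc ∑ x ∈ univ.filter (fun x : S → Λ => x τ₀ = a), (∏ u, K u x) * ‖ursellOf (moment c (Gx x)) univ‖
      ≤ ∑ x ∈ univ.filter (fun x : S → Λ => x τ₀ = a), (∏ u, K u x) *
          ∑ T ∈ lineSets v (univ : Finset ι), δ ^ Fintype.card F * ∏ ℓ ∈ T, ∑ q ∈ LT ℓ, g q x :=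
        sum_le_sum fun x _ => mul_le_mul_of_nonneg_left (step1 x) (hKprod x)
    _ = ∑ T ∈ lineSets v (univ : Finset ι), δ ^ Fintype.card F *
          ∑ x ∈ univ.filter (fun x : S → Λ => x τ₀ = a), (∏ u, K u x) * ∏ ℓ ∈ T, ∑ q ∈ LT ℓ, g q x := by
        simp_rw [Finset.mul_sum]
        rw [Finset.sum_comm]
        refine sum_congr rfl fun T _ => sum_congr rfl fun x _ => ?_
        ring
    _ ≤ ∑ _T ∈ lineSets v (univ : Finset ι), δ ^ Fintype.card F *
          ((2 * (n : ℝ) ^ 2 * Γ) ^ (Fintype.card ι - 1) * ∏ u, N u) :=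
        sum_le_sum fun T hT => mul_le_mul_of_nonneg_left (step2 T hT) (by positivity)
    _ = (lineSets v (univ : Finset ι)).card *
          (δ ^ Fintype.card F * ((2 * (n : ℝ) ^ 2 * Γ) ^ (Fintype.card ι - 1) * ∏ u, N u)) := by
        rw [sum_const, nsmul_eq_mul]
    _ ≤ (Fintype.card ι : ℝ) ^ (Fintype.card ι - 2) *
          (δ ^ Fintype.card F * ((2 * (n : ℝ) ^ 2 * Γ) ^ (Fintype.card ι - 1) * ∏ u, N u)) := by
        refine mul_le_mul_of_nonneg_right ?_ (by positivity)
        have h := card_lineSets_le_pow hv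
        rw [card_univ] at h
        exact_mod_cast h
    _ = (Fintype.card ι : ℝ) ^ (Fintype.card ι - 2) *
          (δ ^ Fintype.card F * (2 * (n : ℝ) ^ 2 * Γ) ^ (Fintype.card ι - 1)) * ∏ u, N u := by
        ring

/-- **The single-scale `n!`-free estimate for extended (kernel-weighted) vertices, translation invariant
form**: positions in a finite abelian group `Λ` and the line bound `‖G_x f f'‖ ≤ γ(x(sb f) - x(su f'))`
(`γ ≥ 0`, row and column sums `Σ_z γ z`); then
`Σ_{x : x τ₀ = a} (∏_u K u x) ‖𝓔ᵀ_x(ι)‖ ≤ |ι|^{|ι|-2} · δ^{|F|} (2 n² Σ_z γ z)^{|ι|-1} · ∏_u N u`.  For local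
clusters (`K u` = the indicator that all slots of `u` coincide, `N u = 1`) this is
`sum_norm_ursellOf_moment_le_of_detBound` of `FermionicTreeExpansionDetBoundDecay.lean`.
[cite: BenfattoGiulianiMastropietro2006, (2.66)-(2.77)] -/
theorem sum_kernel_norm_ursellOf_moment_le_of_detBound (cS : S → ι) (Gx : (S → Λ) → Matrix F F 𝕜)
    {δ : ℝ} (hδ : 1 ≤ δ)
    (hDB : ∀ (x : S → Λ) (m r : ℕ) (w : Fin r → EuclideanSpace ℝ (Fin m)), (∀ a, ‖w a‖ = 1) →
      ∀ (e : Fin r ↪o F) (c' : ℕ) (ρ γ : Fin c' → Fin r), StrictMono ρ → StrictMono γ →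
        ‖(Matrix.of fun a b : Fin c' =>
            ((⟪w (ρ a), w (γ b)⟫_ℝ : ℝ) : 𝕜) * Gx x (e (ρ a)) (e (γ b))).det‖ ≤ δ ^ c')
    (γ : Λ → ℝ) (hγ0 : ∀ z, 0 ≤ γ z) (sb su : F → S) (hsb : ∀ f, cS (sb f) = c f)
    (hsu : ∀ f, cS (su f) = c f) (hG : ∀ x f f', ‖Gx x f f'‖ ≤ γ (x (sb f) - x (su f')))
    (n : ℕ) (hn : ∀ u : ι, (fieldsOf c {u}).card ≤ n)
    (K : ι → (S → Λ) → ℝ) (hK0 : ∀ u x, 0 ≤ K u x)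
    (hKloc : ∀ u x x', (∀ τ, cS τ = u → x τ = x' τ) → K u x = K u x')
    (N : ι → ℝ) (hN0 : ∀ u, 0 ≤ N u)
    (hKN : ∀ u τ, cS τ = u → ∀ a : Λ,
      ∑ x ∈ univ.filter (fun x : S → Λ => x τ = a ∧ ∀ τ', cS τ' ≠ u → x τ' = 0), K u x ≤ N u)
    {v : ι} (τ₀ : S) (hτ₀ : cS τ₀ = v) (a : Λ) :
    ∑ x ∈ univ.filter (fun x : S → Λ => x τ₀ = a), (∏ u, K u x) * ‖ursellOf (moment c (Gx x)) univ‖ ≤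
      (Fintype.card ι : ℝ) ^ (Fintype.card ι - 2) *
        (δ ^ Fintype.card F * (2 * (n : ℝ) ^ 2 * ∑ z, γ z) ^ (Fintype.card ι - 1)) * ∏ u, N u :=
  sum_kernel_norm_ursellOf_moment_le_of_twoPointBound c cS Gx hδ hDB (fun b b' => γ (b - b'))
    (fun _ _ => hγ0 _) (fun b => le_of_eq ((Equiv.subLeft b).sum_comp γ))
    (fun b' => le_of_eq ((Equiv.subRight b').sum_comp γ)) sb su hsb hsu hG n hn K hK0 hKloc N hN0 hKN
    τ₀ hτ₀ a

end Main

end FermionicTree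

end Literature.MathematicalPhysics.QuantumLattice
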